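import Summits.Ventures.PercRepro.RankLevelSetRuleQCell

/-!
# PercRepro — RULE Q AT THE TIGHT LAYER: THE CELL INEQUALITIES `RhatCell q k` BY KERNEL EVALUATION (RankLevelSetRuleQCellEvalQ6B; night-1, gen 14)

Each theorem `rhatCell_q_k : RhatCell q k` (`∀ m ≤ q, Φ(q+k, q) ≤ R̂(q, k, m)`, RankLevelSetRuleQCell) is discharged by
`interval_cases m` and `norm_num` on the unfolded binomial sums (`Nat.choose` by its recursion; the
`Finset.Ioo`-sums as `Finset.range`-sums via `sum_Ioo_nat`). No `native_decide`, no `decide` on the rationals. With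
`hallUp_of_ncard_eq_of_rhatCell` each cell gives the UP form of C-044 at the tight layer `#E = (q+k) + q` of the cell
`(q+k, q)` for every finite matroid; the DOWN form is `hallDown_of_ncard_eq`. Cells: (6,9), (6,10), (6,11), (6,12).
Axioms: standard.
-/

namespace PercRepro

open Finset

/-- `Φ(15, 6) ≤ R̂(6, 9, 0)` (the cell `(15, 6)` at `#P = 0`), by kernel evaluation. -/
theorem rhatCell_6_9_0 : phiK (6 + 9) 6 ≤ rhat 6 9 0 := by
  simp only [rhat, phiK, mhat, sum_Ioo_nat]
  norm_num [Finset.sum_range_succ, Nat.choose, Nat.min_def]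

/-- `Φ(15, 6) ≤ R̂(6, 9, 1)` (the cell `(15, 6)` at `#P = 1`), by kernel evaluation. -/
theorem rhatCell_6_9_1 : phiK (6 + 9) 6 ≤ rhat 6 9 1 := by
  simp only [rhat, phiK, mhat, sum_Ioo_nat]
  norm_num [Finset.sum_range_succ, Nat.choose, Nat.min_def]

/-- `Φ(15, 6) ≤ R̂(6, 9, 2)` (the cell `(15, 6)` at `#P = 2`), by kernel evaluation. -/
theorem rhatCell_6_9_2 : phiK (6 + 9) 6 ≤ rhat 6 9 2 := by
  simp only [rhat, phiK, mhat, sum_Ioo_nat]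
  norm_num [Finset.sum_range_succ, Nat.choose, Nat.min_def]

/-- `Φ(15, 6) ≤ R̂(6, 9, 3)` (the cell `(15, 6)` at `#P = 3`), by kernel evaluation. -/
theorem rhatCell_6_9_3 : phiK (6 + 9) 6 ≤ rhat 6 9 3 := by
  simp only [rhat, phiK, mhat, sum_Ioo_nat]
  norm_num [Finset.sum_range_succ, Nat.choose, Nat.min_def]

/-- `Φ(15, 6) ≤ R̂(6, 9, 4)` (the cell `(15, 6)` at `#P = 4`), by kernel evaluation. -/
theorem rhatCell_6_9_4 : phiK (6 + 9) 6 ≤ rhat 6 9 4 := by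
  simp only [rhat, phiK, mhat, sum_Ioo_nat]
  norm_num [Finset.sum_range_succ, Nat.choose, Nat.min_def]

/-- `Φ(15, 6) ≤ R̂(6, 9, 5)` (the cell `(15, 6)` at `#P = 5`), by kernel evaluation. -/
theorem rhatCell_6_9_5 : phiK (6 + 9) 6 ≤ rhat 6 9 5 := by
  simp only [rhat, phiK, mhat, sum_Ioo_nat]
  norm_num [Finset.sum_range_succ, Nat.choose, Nat.min_def]

/-- `Φ(15, 6) ≤ R̂(6, 9, 6)` (the cell `(15, 6)` at `#P = 6`), by kernel evaluation. -/
theorem rhatCell_6_9_6 : phiK (6 + 9) 6 ≤ rhat 6 9 6 := by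
  simp only [rhat, phiK, mhat, sum_Ioo_nat]
  norm_num [Finset.sum_range_succ, Nat.choose, Nat.min_def]

/-- The cell `(15, 6)` (`q = 6`, `k = 9`): `Φ(15, 6) ≤ R̂(6, 9, m)` for every `m ≤ 6`. -/
theorem rhatCell_6_9 : RhatCell 6 9 := by
  intro m hm
  interval_cases m
  · exact rhatCell_6_9_0
  · exact rhatCell_6_9_1
  · exact rhatCell_6_9_2
  · exact rhatCell_6_9_3
  · exact rhatCell_6_9_4
  · exact rhatCell_6_9_5
  · exact rhatCell_6_9_6

/-- `Φ(16, 6) ≤ R̂(6, 10, 0)` (the cell `(16, 6)` at `#P = 0`), by kernel evaluation. -/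
theorem rhatCell_6_10_0 : phiK (6 + 10) 6 ≤ rhat 6 10 0 := by
  simp only [rhat, phiK, mhat, sum_Ioo_nat]
  norm_num [Finset.sum_range_succ, Nat.choose, Nat.min_def]

/-- `Φ(16, 6) ≤ R̂(6, 10, 1)` (the cell `(16, 6)` at `#P = 1`), by kernel evaluation. -/
theorem rhatCell_6_10_1 : phiK (6 + 10) 6 ≤ rhat 6 10 1 := by
  simp only [rhat, phiK, mhat, sum_Ioo_nat]
  norm_num [Finset.sum_range_succ, Nat.choose, Nat.min_def]

/-- `Φ(16, 6) ≤ R̂(6, 10, 2)` (the cell `(16, 6)` at `#P = 2`), by kernel evaluation. -/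
theorem rhatCell_6_10_2 : phiK (6 + 10) 6 ≤ rhat 6 10 2 := by
  simp only [rhat, phiK, mhat, sum_Ioo_nat]
  norm_num [Finset.sum_range_succ, Nat.choose, Nat.min_def]

/-- `Φ(16, 6) ≤ R̂(6, 10, 3)` (the cell `(16, 6)` at `#P = 3`), by kernel evaluation. -/
theorem rhatCell_6_10_3 : phiK (6 + 10) 6 ≤ rhat 6 10 3 := by
  simp only [rhat, phiK, mhat, sum_Ioo_nat]
  norm_num [Finset.sum_range_succ, Nat.choose, Nat.min_def]

/-- `Φ(16, 6) ≤ R̂(6, 10, 4)` (the cell `(16, 6)` at `#P = 4`), by kernel evaluation. -/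
theorem rhatCell_6_10_4 : phiK (6 + 10) 6 ≤ rhat 6 10 4 := by
  simp only [rhat, phiK, mhat, sum_Ioo_nat]
  norm_num [Finset.sum_range_succ, Nat.choose, Nat.min_def]

/-- `Φ(16, 6) ≤ R̂(6, 10, 5)` (the cell `(16, 6)` at `#P = 5`), by kernel evaluation. -/
theorem rhatCell_6_10_5 : phiK (6 + 10) 6 ≤ rhat 6 10 5 := by
  simp only [rhat, phiK, mhat, sum_Ioo_nat]
  norm_num [Finset.sum_range_succ, Nat.choose, Nat.min_def]

/-- `Φ(16, 6) ≤ R̂(6, 10, 6)` (the cell `(16, 6)` at `#P = 6`), by kernel evaluation. -/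
theorem rhatCell_6_10_6 : phiK (6 + 10) 6 ≤ rhat 6 10 6 := by
  simp only [rhat, phiK, mhat, sum_Ioo_nat]
  norm_num [Finset.sum_range_succ, Nat.choose, Nat.min_def]

/-- The cell `(16, 6)` (`q = 6`, `k = 10`): `Φ(16, 6) ≤ R̂(6, 10, m)` for every `m ≤ 6`. -/
theorem rhatCell_6_10 : RhatCell 6 10 := by
  intro m hm
  interval_cases m
  · exact rhatCell_6_10_0
  · exact rhatCell_6_10_1
  · exact rhatCell_6_10_2
  · exact rhatCell_6_10_3
  · exact rhatCell_6_10_4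
  · exact rhatCell_6_10_5
  · exact rhatCell_6_10_6

/-- `Φ(17, 6) ≤ R̂(6, 11, 0)` (the cell `(17, 6)` at `#P = 0`), by kernel evaluation. -/
theorem rhatCell_6_11_0 : phiK (6 + 11) 6 ≤ rhat 6 11 0 := by
  simp only [rhat, phiK, mhat, sum_Ioo_nat]
  norm_num [Finset.sum_range_succ, Nat.choose, Nat.min_def]

/-- `Φ(17, 6) ≤ R̂(6, 11, 1)` (the cell `(17, 6)` at `#P = 1`), by kernel evaluation. -/
theorem rhatCell_6_11_1 : phiK (6 + 11) 6 ≤ rhat 6 11 1 := by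
  simp only [rhat, phiK, mhat, sum_Ioo_nat]
  norm_num [Finset.sum_range_succ, Nat.choose, Nat.min_def]

/-- `Φ(17, 6) ≤ R̂(6, 11, 2)` (the cell `(17, 6)` at `#P = 2`), by kernel evaluation. -/
theorem rhatCell_6_11_2 : phiK (6 + 11) 6 ≤ rhat 6 11 2 := by
  simp only [rhat, phiK, mhat, sum_Ioo_nat]
  norm_num [Finset.sum_range_succ, Nat.choose, Nat.min_def]

/-- `Φ(17, 6) ≤ R̂(6, 11, 3)` (the cell `(17, 6)` at `#P = 3`), by kernel evaluation. -/
theorem rhatCell_6_11_3 : phiK (6 + 11) 6 ≤ rhat 6 11 3 := by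
  simp only [rhat, phiK, mhat, sum_Ioo_nat]
  norm_num [Finset.sum_range_succ, Nat.choose, Nat.min_def]

/-- `Φ(17, 6) ≤ R̂(6, 11, 4)` (the cell `(17, 6)` at `#P = 4`), by kernel evaluation. -/
theorem rhatCell_6_11_4 : phiK (6 + 11) 6 ≤ rhat 6 11 4 := by
  simp only [rhat, phiK, mhat, sum_Ioo_nat]
  norm_num [Finset.sum_range_succ, Nat.choose, Nat.min_def]

/-- `Φ(17, 6) ≤ R̂(6, 11, 5)` (the cell `(17, 6)` at `#P = 5`), by kernel evaluation. -/
theorem rhatCell_6_11_5 : phiK (6 + 11) 6 ≤ rhat 6 11 5 := by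
  simp only [rhat, phiK, mhat, sum_Ioo_nat]
  norm_num [Finset.sum_range_succ, Nat.choose, Nat.min_def]

/-- `Φ(17, 6) ≤ R̂(6, 11, 6)` (the cell `(17, 6)` at `#P = 6`), by kernel evaluation. -/
theorem rhatCell_6_11_6 : phiK (6 + 11) 6 ≤ rhat 6 11 6 := by
  simp only [rhat, phiK, mhat, sum_Ioo_nat]
  norm_num [Finset.sum_range_succ, Nat.choose, Nat.min_def]

/-- The cell `(17, 6)` (`q = 6`, `k = 11`): `Φ(17, 6) ≤ R̂(6, 11, m)` for every `m ≤ 6`. -/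
theorem rhatCell_6_11 : RhatCell 6 11 := by
  intro m hm
  interval_cases m
  · exact rhatCell_6_11_0
  · exact rhatCell_6_11_1
  · exact rhatCell_6_11_2
  · exact rhatCell_6_11_3
  · exact rhatCell_6_11_4
  · exact rhatCell_6_11_5
  · exact rhatCell_6_11_6

/-- `Φ(18, 6) ≤ R̂(6, 12, 0)` (the cell `(18, 6)` at `#P = 0`), by kernel evaluation. -/
theorem rhatCell_6_12_0 : phiK (6 + 12) 6 ≤ rhat 6 12 0 := by
  simp only [rhat, phiK, mhat, sum_Ioo_nat]
  norm_num [Finset.sum_range_succ, Nat.choose, Nat.min_def]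

/-- `Φ(18, 6) ≤ R̂(6, 12, 1)` (the cell `(18, 6)` at `#P = 1`), by kernel evaluation. -/
theorem rhatCell_6_12_1 : phiK (6 + 12) 6 ≤ rhat 6 12 1 := by
  simp only [rhat, phiK, mhat, sum_Ioo_nat]
  norm_num [Finset.sum_range_succ, Nat.choose, Nat.min_def]

/-- `Φ(18, 6) ≤ R̂(6, 12, 2)` (the cell `(18, 6)` at `#P = 2`), by kernel evaluation. -/
theorem rhatCell_6_12_2 : phiK (6 + 12) 6 ≤ rhat 6 12 2 := by
  simp only [rhat, phiK, mhat, sum_Ioo_nat]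
  norm_num [Finset.sum_range_succ, Nat.choose, Nat.min_def]

/-- `Φ(18, 6) ≤ R̂(6, 12, 3)` (the cell `(18, 6)` at `#P = 3`), by kernel evaluation. -/
theorem rhatCell_6_12_3 : phiK (6 + 12) 6 ≤ rhat 6 12 3 := by
  simp only [rhat, phiK, mhat, sum_Ioo_nat]
  norm_num [Finset.sum_range_succ, Nat.choose, Nat.min_def]

/-- `Φ(18, 6) ≤ R̂(6, 12, 4)` (the cell `(18, 6)` at `#P = 4`), by kernel evaluation. -/
theorem rhatCell_6_12_4 : phiK (6 + 12) 6 ≤ rhat 6 12 4 := by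
  simp only [rhat, phiK, mhat, sum_Ioo_nat]
  norm_num [Finset.sum_range_succ, Nat.choose, Nat.min_def]

/-- `Φ(18, 6) ≤ R̂(6, 12, 5)` (the cell `(18, 6)` at `#P = 5`), by kernel evaluation. -/
theorem rhatCell_6_12_5 : phiK (6 + 12) 6 ≤ rhat 6 12 5 := by
  simp only [rhat, phiK, mhat, sum_Ioo_nat]
  norm_num [Finset.sum_range_succ, Nat.choose, Nat.min_def]

/-- `Φ(18, 6) ≤ R̂(6, 12, 6)` (the cell `(18, 6)` at `#P = 6`), by kernel evaluation. -/
theorem rhatCell_6_12_6 : phiK (6 + 12) 6 ≤ rhat 6 12 6 := by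
  simp only [rhat, phiK, mhat, sum_Ioo_nat]
  norm_num [Finset.sum_range_succ, Nat.choose, Nat.min_def]

/-- The cell `(18, 6)` (`q = 6`, `k = 12`): `Φ(18, 6) ≤ R̂(6, 12, m)` for every `m ≤ 6`. -/
theorem rhatCell_6_12 : RhatCell 6 12 := by
  intro m hm
  interval_cases m
  · exact rhatCell_6_12_0
  · exact rhatCell_6_12_1
  · exact rhatCell_6_12_2
  · exact rhatCell_6_12_3
  · exact rhatCell_6_12_4
  · exact rhatCell_6_12_5
  · exact rhatCell_6_12_6

end PercRepro
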